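import Summits.FinalStateConjecture.FinalStateConjecture.Theses.ClusterCompleteness
import Summits.FinalStateConjecture.FinalStateConjecture.Theorems.ClusterCompletenessLinearToNonlinearCaptureStubScriOfEntry
import Summits.FinalStateConjecture.FinalStateConjecture.Theorems.StarvedNecksHonestFixedRadiusSettlingStubEntryBookkeeping
import Literature.Geometry.Lorentzian.HorizonLineage

/-!
# Crux `LinearToNonlinearCapture` (stmt-FinalStateConjecture-14526) — skeleton of line
# `exterior-entry-capture` (crux-strategist / wall-breaker
# `planner-cstrat-stmt-FinalStateConjecture-14526-p1-0`, 2026-08-17; census `STRATEGY-CENSUS.md`)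

Crux: `LinearToNonlinearCapture := AdiabaticMultiKerrILED → RecurrentMultiKerrCapture` (`#2 → X`,
route `ClusterCompleteness` rev 21 — the route file elaborates again since the rev-21 repair of
2026-08-16T23:24:55Z; the c11/a2 "route broken" alert is obsolete). `#2` is a closed scalar-wave
`Prop` that no proof about a development can apply (Cert14526, p115432), so the line proves `X`
and discards the engine binder, as every honest line for this crux must.

THE LINE. The exhausted chain (four dead lines, eleven leads) died everywhere on the same
obstruction set {Kerr-family capture from recurrence; its `N ≥ 2` analogue; F1 far-exterior null
completeness for the admissible class} — and, at the scri column, on a MIS-CUT interface: the far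
input was typed as COMPLETENESS ONLY (`hK` of p112138), while the entering half (`hE` of p112248:
REACH + FRAME PINNING of far rays into the settled flat chart) needs METRIC control of the far
exterior to bound the Doppler factor a far ray accumulates before it reaches the charted era. This
line re-cuts the crux along the transfer anatomy of the census (T1 far exterior / F2 entry / scri
plumbing / capture core) so that (i) the scri column is stated ONCE for every settled development of
admissible data (recurrence-free, `N`-free, engine-free — summit-wide statements), against the
RE-TYPED settle matrix of rev 21 (`RaysStayInClosure`, `HasExhaustiveCharts` with honest radii,
`IsFutureOriented` are now HYPOTHESES of the entry step, which is exactly what REACH needs: complete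
far rays stay in `closure O`, chart-late points of `O` are charted, chart time is the `g`-future);
(ii) the entering-half plumbing becomes a closable stub (port of p112248 + p112138 + the halves
assembly to the T2 matrix, over the LANDED rate-free sojourn lever `StarvedNecks…stub_flatZoneSojourn`);
(iii) the far-exterior input and the entry lemma are SEPARATE stubs, so that the design question
"what must a Klainerman–Nicolò theorem for the admissible class SAY for its consumers" (F1′: metric
control, not only completeness) is posed by `stub_radiationZoneEntry`'s statement and answered by
its workers' typed facts, instead of blocking a whole column; (iv) the capture core is ONE stub,
verbatim the split child `AnchoredRecurrenceSettles` (X minus scri; necessary), ready for the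
harness-offered reduction on a final cycle (`children.json` + `SplitT2.lean`, evidence #89 on the
item: `route edit --split` was refused to this seat on cycle grounds only).

REGISTERED STUBS (sorries only here; every signature < 4000 chars) — skeleton v5, lead c13,
2026-08-17 (c12's wave-2 reshape kept: S_A/S_B DERIVED from the far-exterior residual F″ and the
entry-band geometry stub; c13 wave 1: G `stub_entryBandGlue` (pointwise pinning) found MISSTATED by
its worker — log-boost vortex decompositions — and REPLACED by the ray-wise eventual G′
`stub_entryBandGlue_eventual`, S_B re-derived; c13 wave 2: G′ itself DERIVED from the two finer
registered stubs L3 `stub_lateBandCoverage` + L6 `stub_rayTransience` (worker's typed reduction,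
sorry-free certificate); F″/S_D docstrings revised after the F″ literature sweep and the lead's
AUDIT-c13 of the statement-concern):
* F″ `stub_farExteriorControl` — ONE Klainerman–Nicolò-type statement for the admissible class:
  ∃ compact `K`, `R C U Φ` with (COMPLETE) `K`-avoiding normalised rays complete (the former S_A,
  verbatim) ∧ (FAR CHART) `Φ` a smooth open embedding, cone-adapted shell, covering
  `J⁺(ιΣ) ∖ J⁺(ιK)`, `dΦ(∂₀)` future-directed, WEIGHTED `C⁰/C¹` closeness to `η` (no `C²` line:
  rough admissible tails focus O(1) curvature to late far points — crux evidence
  `STATEMENT-CONCERN-far-curvature-spikes.md`) ∧ (ESCAPE) ∧ (FAR ENTRY, Doppler ∈ [1/2, 2], entry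
  band). Printed one weighted derivative and 1/2+η of rate up (KN 2003 Thm 3.7.1, vendored
  completeness-only p140430; Shen arXiv:2303.12758 Thm 1.7 + layer). [XL; research-grade; FRONTIER:
  per-scale short-time existence does not reach completeness — a semi-global small-data exterior
  theorem at the scale-critical `H²` level is needed. c13 wave-1 sweep (31 works through 2026-05,
  evidence `stub_farExteriorControl.findings.md`): the class is `(s,q) = (3,1)` in Shen's
  bookkeeping; every printed exterior/global vacuum theorem needs `q ≥ 2` (Bieri `(2,2)`, Shen
  `(3+δ,2)`/`(1,3)`, KN `(4,3)`), and the `s = 3`-level weighted L² functionals diverge on the class: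
  two walls, `Δq = 1` and `s = 3` exact; the `q = 1` exterior problem is not posed in print]
* L3 `stub_lateBandCoverage` — late far-charted entry-band points of `closure O` are `d`-flat-charted
  with LINEAR chart time and LINEAR room (Lorentzian John at the position level + anchoring +
  degree). [L]
* L6 `stub_rayTransience` — along a normalised null ray sitting at such a point, a `d`-flat-charted
  parameter with chart energy `≤ L` occurs within any prescribed linear fraction of the room, or the
  ray is complete (ray-wise John–Nirenberg / clock lemma; vortex cores are transient along rays). [XL]
* G′ `stub_entryBandGlue_eventual` — DERIVED (v5) from L3 + L6 — entry-band chart geometry, RAY-WISE EVENTUAL: from a legal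
  exhaustive future-oriented `C²` decomposition `d` and a far chart of F″-quality, a legal `C²`
  decomposition `d′` (intended `d` with `τ₀` raised) and ONE `L` such that every normalised null ray
  sitting at a late far-charted entry-band point of `closure O` with `Φ`-energy `w⁰ ≤ 2` is complete
  or has a LATER `d′`-flat-charted point in `J⁺` of the entry point, late, with room, pinned
  `0 < w′⁰ ≤ L`. (v3's pointwise G — pin all null directions at every late band point — is broken by
  band-centred log-boost vortices of `d`, legal at every order with unbounded tilt when
  `δ₀(σ) log σ → ∞`; vortices are transient along rays, which G′ exploits; rigidity is BMO-type,
  O(δ₀) per octave.) [classical Lorentzian geometry: Lorentzian John / John–Nirenberg for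
  near-isometric charts + coverage; XL in Lean, toolkit 0 in tree]
* S_A `stub_farExteriorNullCompleteness` — DERIVED (projection of F″), registered signature kept.
* S_B `stub_radiationZoneEntry` — DERIVED (40-line causal certificate from F″ + G′: REACH via
  `nullRay_apply_mem_causalFuture` + ESCAPE + completeness + `RaysStayInClosure`; then G′'s later
  good event and `J⁺ ∘ J⁺ ⊆ J⁺`), registered signature kept.
* S_C `stub_scriOfEntry` — CLOSED (p139865, 2026-08-17T02:59Z): far-complete + entry events ⇒
  complete `𝓘⁺` (sojourn form), the landed `Theorems.stub_scriOfEntry`.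
* S_D `stub_anchoredRecurrenceSettles` — the capture core: `∃ k`, X's rev-21 hypothesis VERBATIM ⇒ the
  re-typed settle matrix (split child C_C; necessary: `stub_anchoredRecurrenceSettles_of_target`).
  Honestly crux-sized (X minus scri). NOTE (lead c12, confirmed by c13's audit of the
  STATEMENT-CONCERN, v2): a proof must take `k ≥ 4` and USE whole-slab C⁴ recurrence to exclude
  incoming far-field roughness (at every fixed `k ≤ 3` the instance is refuted by Schwarzschild +
  sparse thin caps, modulo far-development existence); this is an artifact of the DR class
  (`nh = 2, nk = 1`) against a pointwise C² conclusion (`nh ≥ m + 1` would remove it) and does NOT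
  touch the tame-generic Statement or #9 (rough tails are tame-excisable by peeling). The LaSalle
  plan (`Ideas/lasalle-capture.md`) is not typable over HYP's adversarial charts (c12 design note).
  Held by the lead; exit = promote-stub / the prepared split. [XL, hardest]

COMPOSITION `LinearToNonlinearCapture_of` (hypothesis-free, stubs by name): discard the engine binder; `k` from S_D; for a recurrent
development S_D gives the settle matrix, S_A (from F″) far completeness, S_B (from F″ + G′) entry events, S_C complete `𝓘⁺`.
Pure logic, no `sorry` outside the four open stubs F″, L3, L6, S_D; the conclusion is the route decl BY NAME.

DISPROOF USED: none exists for this crux (no `Disproof.lean` was ever mounted, `ledger crux ls`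
2026-08-17T01:0xZ). Honoured instead: Cert14526 (engine inert ⇒ prove X); `Lines/Sketch-dead.md` §3
(no stub is Col₂ re-lettered: the scri column is recurrence-free and cut at far/entry/plumbing; S_D
IS Col₁ ∪ the `N = 0` column by design — the declared core, not a hidden one); triage F-d (every
stub keeps `∃ k` / concludes `C²` only from the settle matrix, never from order-≤ 3 recurrence);
negatives index (UniformPhotonSphereChannels — untouched); refuted static crux stmt-10719 (no
inter-hole positivity asserted anywhere).
-/

namespace Summit.FinalStateConjecture.FinalStateConjecture.Cruxes.LinearToNonlinearCapture.ExteriorEntryCapture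

set_option linter.dupNamespace false
-- nested operator types `E4 →L[ℝ] E4 →L[ℝ] ℝ` and their iterated derivatives
set_option maxSynthPendingDepth 3

open scoped BigOperators Topology Manifold ENNReal ContDiff
open Filter Set Function TopologicalSpace Bundle MeasureTheory
open Literature.Geometry.Lorentzian
open Summit.FinalStateConjecture.FinalStateConjecture.Theses.ClusterCompleteness
open Summit.FinalStateConjecture.FinalStateConjecture.Theorems.StarvedNecks.OneOverDelta

/-- **Stub S_B1 (`stub_farExteriorControl`, F″: the far exterior of a maximal development of
admissible data — completeness AND metric control, ONE statement).** For every admissible vacuum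
datum and every maximal vacuum Cauchy development `𝒟` there are a compact `K ⊆ Σ`, constants
`R, C`, an open `U ⊆ E4` and a far chart `Φ : U → 𝒟` such that
* (COMPLETE) every normalised future null ray from `Σ` never entering `J⁺(ι K)` is future complete
  (verbatim the matrix of the former stub S_A);
* (FAR CHART) `Φ` is a smooth open embedding; `U` contains the cone-adapted shell
  `{0 < x⁰, x⁰ + R < |x⃗|}`; the far exterior `J⁺(ι Σ) ∖ J⁺(ι K)` is covered by
  `Φ{0 ≤ x⁰, x⁰ + R < |x⃗|}`; `dΦ(∂₀)` is future-directed causal; and `Φ^* g − η` is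
  WEIGHTED-small in `C¹` (NOT `C²` — lead c12, 2026-08-17: pointwise curvature at late far points
  is fed by `∂³h, ∂²k` of the data, which the admissible class leaves free, and thin far caps focus
  O(1) curvature spikes to arbitrarily late far points; crux evidence
  `STATEMENT-CONCERN-far-curvature-spikes.md`): `‖h‖ ≤ C log(2+r)/(1+r)` and
  `‖∂h‖ ≤ C log(2+r)/((1+r)(1+|x⁰ − r|))` (`r = |x⃗|`; the `log` absorbs the `2M log r` shift of
  cone-adapted (tortoise) coordinates; the null-structure factor `(1+|x⁰−r|)⁻¹` makes `∂h`
  integrable along the far part of every slab, which pins the chart's Lorentz frame at `i⁰` and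
  bounds the Doppler factor of far rays; `C¹` at late far points is fed by `∂²h, ∂k` of the data,
  which ARE pointwise controlled);
* (ESCAPE) for every compact `K'` a compact `K''` such that through every point of
  `J⁺(ι Σ) ∖ J⁺(ι K'')` passes, at a parameter `≥ 0`, a normalised null ray from `Σ` never entering
  `J⁺(ι K')` (the outgoing radial ray);
* (FAR ENTRY) for every compact `K'` a compact `B*` such that for every compact `B ⊇ B*` there is a
  retarded width `R'` and, for every `t₁`, a compact `B₁` beyond which every normalised null ray
  entering `J⁺(ι B)` has a parameter `s₀ ≥ 0` with `γ s₀ ∈ J⁺(ι B) ∖ J⁺(ι K')` the far-charted point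
  `Φ x`, `x⁰ ≥ t₁`, in the ENTRY BAND `x⁰ + R < |x⃗| ≤ x⁰ + R'`, with chart velocity `dΦ w` of
  Doppler factor `1/2 ≤ w⁰ ≤ 2`.
Minkowski: `Φ = id`, `K = B̄(R)`, `C = 0`, entry of the ray `(s, p⃗ + s v̂)` into `J⁺(B̄(ρ))` at
`|x⃗| − x⁰ = ρ`, `w⁰ = 1`; Schwarzschild far out: `x⁰ = t`, `|x⃗| = r*`, `h ~ M log r / r`,
`E = (1−2M/r)ṫ` conserved. Klainerman–Nicolò 2003, Thm 3.7.1 (i)–(iii) proves all of this one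
weighted derivative and `1/2 + η` of decay above the admissible class (vendored for that class as
`klainerman_nicolo_exterior_null_completeness`, completeness part only); Shen arXiv:2303.12758
Thm 1.7 needs a layer hypothesis. Unprinted for `h = (1+2M/r)δ + o₂(r⁻¹)`, `k = o₁(r⁻²)`:
research-grade, believed true. [XL] -/
theorem stub_farExteriorControl :
    ∀ (X : Type) [TopologicalSpace X] [ChartedSpace E3 X] [IsManifold (𝓡 3) ∞ X] [T2Space X]
      [SecondCountableTopology X] [ConnectedSpace X], ∀ D ∈ admissibleVacuumData X, ∀ 𝒟 :
      VacuumCauchyDevelopment D, 𝒟.IsMaximal → ∀ [𝒟.metric.HasLeviCivita], ∃ (K : Set X) (R C : ℝ)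
      (U : Opens E4) (Φ : U → 𝒟.carrier), IsCompact K ∧ (∀ (p : X) (γ : ℝ → 𝒟.carrier) (dom : Set
      ℝ), 𝒟.metric.IsNormalisedNullRayFrom 𝒟.timeOrientation 𝒟.embed 𝒟.normal p γ dom → (∀ t ∈
      dom, 0 ≤ t → γ t ∉ 𝒟.metric.causalFuture 𝒟.timeOrientation (𝒟.embed '' K)) → ¬ BddAbove dom)
      ∧ (ContMDiff 𝓘(ℝ, E4) (𝓡 4) ∞ Φ ∧ Topology.IsOpenEmbedding Φ ∧ {x : E4 | 0 < x 0 ∧ x 0 + R <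
      E4.spatialNorm x} ⊆ (U : Set E4) ∧ 𝒟.metric.causalFuture 𝒟.timeOrientation (range 𝒟.embed) \
      𝒟.metric.causalFuture 𝒟.timeOrientation (𝒟.embed '' K) ⊆ Φ '' {x : U | 0 ≤ x.1 0 ∧ x.1 0 + R
      < E4.spatialNorm x.1} ∧ (∀ x : U, 𝒟.timeOrientation.IsFutureDirected (mfderiv 𝓘(ℝ, E4) (𝓡 4)
      Φ x (E4.basisVector 0))) ∧ (∀ x : U, ‖𝒟.toSpacetime.deviation (Minkowski.backgroundOn U) Φ x‖
      ≤ C * Real.log (2 + E4.spatialNorm x.1) / (1 + E4.spatialNorm x.1)) ∧ (∀ x : U, ‖fderiv ℝ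
      (𝒟.toSpacetime.deviationExtend (Minkowski.backgroundOn U) Φ) x.1‖ ≤ C * Real.log (2 +
      E4.spatialNorm x.1) / ((1 + E4.spatialNorm x.1) * (1 + |x.1 0 - E4.spatialNorm x.1|)))) ∧ (∀ K' : Set X, IsCompact K' →
      ∃ K'' : Set X, IsCompact K'' ∧ ∀ q ∈
      𝒟.metric.causalFuture 𝒟.timeOrientation (range 𝒟.embed), q ∉ 𝒟.metric.causalFuture
      𝒟.timeOrientation (𝒟.embed '' K'') → ∃ (p : X) (γ : ℝ → 𝒟.carrier) (dom : Set ℝ) (t : ℝ),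
      𝒟.metric.IsNormalisedNullRayFrom 𝒟.timeOrientation 𝒟.embed 𝒟.normal p γ dom ∧ t ∈ dom ∧ 0 ≤
      t ∧ γ t = q ∧ ∀ t' ∈ dom, 0 ≤ t' → γ t' ∉ 𝒟.metric.causalFuture 𝒟.timeOrientation (𝒟.embed ''
      K')) ∧ ∀ K' : Set X, IsCompact K' → ∃ Bs : Set X, IsCompact Bs ∧ ∀ B : Set X, IsCompact B → Bs
      ⊆ B → ∃ R' : ℝ, ∀ t₁ : ℝ, ∃ B₁ : Set X, IsCompact B₁ ∧ ∀ p ∉ B₁, ∀ (γ : ℝ → 𝒟.carrier) (dom :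
      Set ℝ), 𝒟.metric.IsNormalisedNullRayFrom 𝒟.timeOrientation 𝒟.embed 𝒟.normal p γ dom → (∃ t ∈
      dom, 0 ≤ t ∧ γ t ∈ 𝒟.metric.causalFuture 𝒟.timeOrientation (𝒟.embed '' B)) → ∃ (s₀ : ℝ) (x :
      U) (w : E4), s₀ ∈ dom ∧ 0 ≤ s₀ ∧ γ s₀ ∈ 𝒟.metric.causalFuture 𝒟.timeOrientation (𝒟.embed ''
      B) ∧ γ s₀ ∉ 𝒟.metric.causalFuture 𝒟.timeOrientation (𝒟.embed '' K') ∧ γ s₀ = Φ x ∧ t₁ ≤ x.1 0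
      ∧ x.1 0 + R < E4.spatialNorm x.1 ∧ E4.spatialNorm x.1 ≤ x.1 0 + R' ∧ velocity (𝓡 4) γ s₀ =
      mfderiv 𝓘(ℝ, E4) (𝓡 4) Φ x w ∧ 1 / 2 ≤ w 0 ∧ w 0 ≤ 2 := by
  sorry

/-- **Stub L3 (`stub_lateBandCoverage`; late-band COVERAGE with linear chart time and linear room —
skeleton v5, lead c13, from the c13 wave-2 worker's typed reduction of G′).** For a legal exhaustive
future-oriented `C²` decomposition `d` of `O = exteriorOf 𝒟 d.charted` and a far chart `Φ` of
F″-quality (FAR CHART block verbatim), there is `c > 0` such that for every outer band width `R′`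
there is `t₁` after which every far-charted entry-band point `Φ x ∈ closure O` (`x⁰ ≥ t₁`,
`x⁰ + R < |x⃗| ≤ x⁰ + R′`) is `d.flatChart y` with `y⁰ ≥ 2 c x⁰` and with the chart bi-disc
`{|z⁰ − y⁰| ≤ c x⁰, ‖z⃗ − y⃗‖ ≤ c x⁰}` inside the flat domain. Intended proof: the flat domain
contains `{y⁰ > τ₀} ∖ tubes` (structure field `setOf_lt_excision_subset_flatDomain`), tubes recede
linearly (`|vᵢ| < 1`, `ρᵢ = o(t)`); the transition map `Φ⁻¹ ∘ flatChart` on the overlap is a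
near-`η`-isometry, so by Lorentzian John (position form, L1) on a chain of doubling Lipschitz
domains it is ONE Poincaré map up to `o(scale)`, its boost anchored by "late slabs lie in
`J⁺(ι Σ)`" and its mean drift `O(δ₀)` per octave (L2); a degree argument puts the band point in
the image; `closure O` + `HasExhaustiveCharts` + no-needles excludes band points charted only
EARLY; the fast-radii loophole (N = 1 near zone swallowing the band) only charts the band twice.
Minkowski: `c = 1/4`, `y = x`. Dafermos–Luk 2017, Conjecture 1 (b) (covering picture); F. John 1961
(rotation and strain). [L; recurrence-free, N-free, engine-free chart geometry; not in tree] -/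
theorem stub_lateBandCoverage :
    ∀ (X : Type) [TopologicalSpace X] [ChartedSpace E3 X] [IsManifold (𝓡 3) ∞ X] [T2Space X]
      [SecondCountableTopology X] [ConnectedSpace X], ∀ D ∈ admissibleVacuumData X, ∀ 𝒟 :
      VacuumCauchyDevelopment D, 𝒟.IsMaximal → ∀ (O : Set 𝒟.carrier) (d : FinalStateDecomposition
      𝒟.toSpacetime O 2), O = Summit.FinalStateConjecture.exteriorOf 𝒟.toCauchyDevelopment d.charted
      → Summit.FinalStateConjecture.HasExhaustiveCharts d →
      Summit.FinalStateConjecture.IsFutureOriented d → ∀ (K : Set X) (R C : ℝ) (U : Opens E4) (Φ : U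
      → 𝒟.carrier), (ContMDiff 𝓘(ℝ, E4) (𝓡 4) ∞ Φ ∧ Topology.IsOpenEmbedding Φ ∧ {x : E4 | 0 < x 0 ∧ x 0 + R
      < E4.spatialNorm x} ⊆ (U : Set E4) ∧ 𝒟.metric.causalFuture 𝒟.timeOrientation (range 𝒟.embed)
      \ 𝒟.metric.causalFuture 𝒟.timeOrientation (𝒟.embed '' K) ⊆ Φ '' {x : U | 0 ≤ x.1 0 ∧ x.1 0 +
      R < E4.spatialNorm x.1} ∧ (∀ x : U, 𝒟.timeOrientation.IsFutureDirected (mfderiv 𝓘(ℝ, E4) (𝓡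
      4) Φ x (E4.basisVector 0))) ∧ (∀ x : U, ‖𝒟.toSpacetime.deviation (Minkowski.backgroundOn U) Φ
      x‖ ≤ C * Real.log (2 + E4.spatialNorm x.1) / (1 + E4.spatialNorm x.1)) ∧ (∀ x : U, ‖fderiv ℝ
      (𝒟.toSpacetime.deviationExtend (Minkowski.backgroundOn U) Φ) x.1‖ ≤ C * Real.log (2 +
      E4.spatialNorm x.1) / ((1 + E4.spatialNorm x.1) * (1 + |x.1 0 - E4.spatialNorm x.1|)))) →
      ∃ c : ℝ, 0 < c ∧ ∀ R' : ℝ, ∃ t₁ : ℝ, ∀ x : U, t₁ ≤ x.1 0 → x.1 0 + R < E4.spatialNorm x.1 →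
      E4.spatialNorm x.1 ≤ x.1 0 + R' → Φ x ∈ closure O →
      ∃ y : d.flatDomain, Φ x = d.flatChart y ∧ 2 * (c * x.1 0) ≤ y.1 0 ∧
        {z : E4 | |z 0 - y.1 0| ≤ c * x.1 0 ∧ ‖E4.spatial z - E4.spatial y.1‖ ≤ c * x.1 0} ⊆
          (d.flatDomain : Set E4) := by
  sorry

/-- **Stub L6 (`stub_rayTransience`; RAY TRANSIENCE — the ray-wise John–Nirenberg / clock lemma —
skeleton v5, lead c13, from the c13 wave-2 worker's typed reduction of G′).** Same hypotheses; there
is ONE `L > 0` such that for every room fraction `ε > 0` and band width `R′` there is `t₁` after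
which: if a normalised null ray `γ` from the data sits at parameter `s₀ ≥ 0` at the far-charted
entry-band point `Φ x = d.flatChart y` (`x⁰ ≥ t₁`) with `Φ`-chart velocity `dΦ w`, `w⁰ ≤ 2`, and
the chart bi-disc of radius `ε x⁰` about `y` lies in the LATE flat domain, then `γ` is future
complete or has a parameter `s ≥ s₀` in its domain at which it is `d.flatChart y′` with `y′` in
the half bi-disc, not earlier in chart time, and with chart velocity `d(flatChart) w′`,
`0 < w′⁰ ≤ L`. WHY TRUE (worker findings §2.2, evidence `stub_entryBandGlue_eventual.findings.md`):
a stretch of the ray of honest length `ℓ` on which the `d`-frame is boosted against the parallel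
frame by Doppler `≥ e^Λ` forces (closedness of `flatChart^*` of an honest retarded time +
positivity on the chart triangle) a whole chart box of side `e^Λ ℓ` to be so boosted, which costs a
log-boost vortex halo of chart size `≥ ℓ e^Λ e^{Λ/δ₀}`; halos are `≤ x⁰`, so bad stretches have
honest length `≤ x⁰ e^{−Λ/δ₀}`, while non-imprisonment makes the ray cross the half bi-disc (chart
length `≥ ε x⁰/2`) unless complete; `L = 2e^{χ+1}` with `χ` the (finite, anchored) relative mean
boost of `d` against `Φ` at band scale; numerics (`ray_transience_check.out`): bad honest lengths
on rays through vortex cores are `≈ √2 R₀ e^{−Λ/ε−0.85} e^{−Λ}`, clock ratio `Δy⁰/Δt = 1.00000`.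
Residual caveat (proof-level): deep inside the cone `Φ` is absent, so an energy-free proof of
near-inertiality at scale `x⁰` at the C¹ level may want F″'s chart exported to `{r > εt}`.
Minkowski: `L = 2`, `s = s₀`. John–Nirenberg 1961; O'Neill 1983 Ch. 3 (geodesic equations in a
chart). [XL; recurrence-free, N-free, engine-free chart geometry; inputs L1, L2 (line form), L4
(inside the landed `stub_flatZoneSojourn`), anchoring; not in tree] -/
theorem stub_rayTransience :
    ∀ (X : Type) [TopologicalSpace X] [ChartedSpace E3 X] [IsManifold (𝓡 3) ∞ X] [T2Space X]
      [SecondCountableTopology X] [ConnectedSpace X], ∀ D ∈ admissibleVacuumData X, ∀ 𝒟 :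
      VacuumCauchyDevelopment D, 𝒟.IsMaximal → ∀ (O : Set 𝒟.carrier) (d : FinalStateDecomposition
      𝒟.toSpacetime O 2), O = Summit.FinalStateConjecture.exteriorOf 𝒟.toCauchyDevelopment d.charted
      → Summit.FinalStateConjecture.HasExhaustiveCharts d →
      Summit.FinalStateConjecture.IsFutureOriented d → ∀ (K : Set X) (R C : ℝ) (U : Opens E4) (Φ : U
      → 𝒟.carrier), (ContMDiff 𝓘(ℝ, E4) (𝓡 4) ∞ Φ ∧ Topology.IsOpenEmbedding Φ ∧ {x : E4 | 0 < x 0 ∧ x 0 + R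
      < E4.spatialNorm x} ⊆ (U : Set E4) ∧ 𝒟.metric.causalFuture 𝒟.timeOrientation (range 𝒟.embed)
      \ 𝒟.metric.causalFuture 𝒟.timeOrientation (𝒟.embed '' K) ⊆ Φ '' {x : U | 0 ≤ x.1 0 ∧ x.1 0 +
      R < E4.spatialNorm x.1} ∧ (∀ x : U, 𝒟.timeOrientation.IsFutureDirected (mfderiv 𝓘(ℝ, E4) (𝓡
      4) Φ x (E4.basisVector 0))) ∧ (∀ x : U, ‖𝒟.toSpacetime.deviation (Minkowski.backgroundOn U) Φ
      x‖ ≤ C * Real.log (2 + E4.spatialNorm x.1) / (1 + E4.spatialNorm x.1)) ∧ (∀ x : U, ‖fderiv ℝ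
      (𝒟.toSpacetime.deviationExtend (Minkowski.backgroundOn U) Φ) x.1‖ ≤ C * Real.log (2 +
      E4.spatialNorm x.1) / ((1 + E4.spatialNorm x.1) * (1 + |x.1 0 - E4.spatialNorm x.1|)))) →
      ∀ [𝒟.metric.HasLeviCivita], ∃ L : ℝ, 0 < L ∧ ∀ ε R' : ℝ, 0 < ε → ∃ t₁ : ℝ,
      ∀ (p : X) (γ : ℝ → 𝒟.carrier) (dom : Set ℝ) (s₀ : ℝ) (x : U) (w : E4) (y : d.flatDomain),
      𝒟.metric.IsNormalisedNullRayFrom 𝒟.timeOrientation 𝒟.embed 𝒟.normal p γ dom → s₀ ∈ dom →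
      0 ≤ s₀ → γ s₀ = Φ x → t₁ ≤ x.1 0 → x.1 0 + R < E4.spatialNorm x.1 →
      E4.spatialNorm x.1 ≤ x.1 0 + R' →
      velocity (𝓡 4) γ s₀ = mfderiv 𝓘(ℝ, E4) (𝓡 4) Φ x w → w 0 ≤ 2 →
      Φ x = d.flatChart y → d.τ₀ < y.1 0 - ε * x.1 0 →
      {z : E4 | |z 0 - y.1 0| ≤ ε * x.1 0 ∧ ‖E4.spatial z - E4.spatial y.1‖ ≤ ε * x.1 0} ⊆
        (d.flatDomain : Set E4) →
      ¬ BddAbove dom ∨ ∃ (s : ℝ) (y' : d.flatDomain) (w' : E4), s ∈ dom ∧ s₀ ≤ s ∧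
        γ s = d.flatChart y' ∧ y.1 0 ≤ y'.1 0 ∧ |y'.1 0 - y.1 0| ≤ ε * x.1 0 / 2 ∧
        ‖E4.spatial y'.1 - E4.spatial y.1‖ ≤ ε * x.1 0 / 2 ∧
        velocity (𝓡 4) γ s = mfderiv 𝓘(ℝ, E4) (𝓡 4) d.flatChart y' w' ∧ 0 < w' 0 ∧ w' 0 ≤ L := by
  sorry

/-- **G′ (`stub_entryBandGlue_eventual`, entry-band gluing and frame pinning, RAY-WISE EVENTUAL form) —
DERIVED since skeleton v5 (lead c13) from the two registered stubs L3 `stub_lateBandCoverage` and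
L6 `stub_rayTransience` by the c13 wave-2 worker's 45-line certificate (`O′ := O`, `d′ := d`, `L`
from L6, `t₁ := max (max t₁ᴸ³ t₁ᴸ⁶) ((|τ₀| + |τ| + 4|T| + 3)/c)`); it replaced (v4) the pointwise G
of v3 which the c13 wave-1 worker showed MISSTATED.** Hypotheses: a maximal vacuum Cauchy development of admissible data, a `C²`
final-state decomposition `d` of its self-determined exterior `O = exteriorOf 𝒟 d.charted` with
exhaustive, future-oriented charts, and a far chart `Φ : U → 𝒟` of the quality produced by
`stub_farExteriorControl` (FAR CHART block verbatim: smooth open embedding, cone-adapted shell,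
covering `J⁺(ι Σ) ∖ J⁺(ι K)`, `dΦ(∂₀)` future-directed, weighted `C⁰/C¹` closeness to `η`).
Conclusion: a `C²` decomposition `d′` of some region and ONE constant `L` such that for all
`R′ τ T` there is `t₁` after which every normalised null ray `γ` from the data which at some
parameter `s₀ ≥ 0` sits at a far-charted ENTRY-BAND point `Φ x ∈ closure O`, `x⁰ ≥ t₁`,
`x⁰ + R < |x⃗| ≤ x⁰ + R′`, with chart velocity `dΦ w`, `w⁰ ≤ 2`, is EITHER future complete OR has, at
some LATER parameter `s ≥ s₀` of its domain, a `d′`-flat-charted point in `J⁺(γ s₀)` which is late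
(`y⁰ > τ₀′`, `y⁰ ≥ τ`), has ROOM (height-`T` slope-2 cone in the flat domain) and is pinned
ABSOLUTELY (`velocity = d(flatChart′) w′`, `0 < w′⁰ ≤ L`). This is exactly what
`stub_radiationZoneEntry` consumes (its entry event becomes this later event; `γ s ∈ J⁺(ι B₀)` by
`J⁺ ∘ J⁺ ⊆ J⁺`). WHY NOT THE POINTWISE G (pin ALL null directions at EVERY late band point with one
`L`, v3): the c13 worker's LOG-BOOST VORTEX decomposition of Minkowski space
(`F(x) = c + Λ(ε g(log(R₀/|x−c|)))(x − c)`, deviation `ε` in C⁰ and `O(ε/ϱᵏ)` in Cᵏ for ALL chart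
times, tilt `ε(log(R₀/r₀) − 1)` at the core — 3.6 … 119 × the C⁰ budget in five verified runs) is a
legal T2 decomposition whose tilt at band-centred cores is unbounded whenever `δ₀(σ) log σ → ∞`
(`FinalStateDecomposition` has no rate), so uniform pointwise pinning fails for `d′ := d ∘ P`; and
the `∃ d′` form would force far-frame curvature decay on the band, which "surfing" decompositions
(inward-boosted vortex cores redshifting sparse incoming packets) show the hypotheses do not give
(findings `stub_entryBandGlue.findings.md` §1.3, §2.1, §3.2, evidence #104). The correct rigidity
law is BMO-type (O(δ₀) per octave of scale, `osc ≤ 12δ₀ log₂(Dδ₁/δ₀) + 4δ₀`, John–Nirenberg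
exceptional sets of density `≤ C e^{−cΛ/δ₀}`), and vortex cores are TRANSIENT ALONG RAYS, which is
what G′ uses: intended proof `d′ := d` with `τ₀` raised, `L := 2e^{χ+1}`, via late-image coverage
with linear chart time (Lorentzian John, position), ray bookkeeping in a `C¹`-small chart (inside
the landed StarvedNecks lever), John–Nirenberg along the post-entry chart-null segment of length
`≥ c x⁰`, and `J⁺`-transitivity. Minkowski: `Φ = id`, `d′ = id`-decomposition, `s = s₀`, `L = 2`;
Schwarzschild exterior as in v3. F. John 1961 (rotation and strain), John–Nirenberg 1961 (BMO);
O'Neill 1983 Ch. 9, 14. [XL in Lean: Lorentzian John / John–Nirenberg for near-isometric charts of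
`E4` + coverage; toolkit 0 in tree (worker's L1–L6: L5 partial)] -/
theorem stub_entryBandGlue_eventual :
    ∀ (X : Type) [TopologicalSpace X] [ChartedSpace E3 X] [IsManifold (𝓡 3) ∞ X] [T2Space X]
      [SecondCountableTopology X] [ConnectedSpace X], ∀ D ∈ admissibleVacuumData X, ∀ 𝒟 :
      VacuumCauchyDevelopment D, 𝒟.IsMaximal → ∀ (O : Set 𝒟.carrier) (d : FinalStateDecomposition
      𝒟.toSpacetime O 2), O = Summit.FinalStateConjecture.exteriorOf 𝒟.toCauchyDevelopment d.charted
      → Summit.FinalStateConjecture.HasExhaustiveCharts d →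
      Summit.FinalStateConjecture.IsFutureOriented d → ∀ (K : Set X) (R C : ℝ) (U : Opens E4) (Φ : U
      → 𝒟.carrier), (ContMDiff 𝓘(ℝ, E4) (𝓡 4) ∞ Φ ∧ Topology.IsOpenEmbedding Φ ∧ {x : E4 | 0 < x 0 ∧ x 0 + R
      < E4.spatialNorm x} ⊆ (U : Set E4) ∧ 𝒟.metric.causalFuture 𝒟.timeOrientation (range 𝒟.embed)
      \ 𝒟.metric.causalFuture 𝒟.timeOrientation (𝒟.embed '' K) ⊆ Φ '' {x : U | 0 ≤ x.1 0 ∧ x.1 0 +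
      R < E4.spatialNorm x.1} ∧ (∀ x : U, 𝒟.timeOrientation.IsFutureDirected (mfderiv 𝓘(ℝ, E4) (𝓡
      4) Φ x (E4.basisVector 0))) ∧ (∀ x : U, ‖𝒟.toSpacetime.deviation (Minkowski.backgroundOn U) Φ
      x‖ ≤ C * Real.log (2 + E4.spatialNorm x.1) / (1 + E4.spatialNorm x.1)) ∧ (∀ x : U, ‖fderiv ℝ
      (𝒟.toSpacetime.deviationExtend (Minkowski.backgroundOn U) Φ) x.1‖ ≤ C * Real.log (2 +
      E4.spatialNorm x.1) / ((1 + E4.spatialNorm x.1) * (1 + |x.1 0 - E4.spatialNorm x.1|)))) →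
      ∀ [𝒟.metric.HasLeviCivita], ∃ (O' : Set 𝒟.carrier) (d' :
      FinalStateDecomposition 𝒟.toSpacetime O' 2) (L : ℝ), 0 < L ∧ ∀ R' τ T : ℝ, ∃ t₁ : ℝ,
      ∀ (p : X) (γ : ℝ → 𝒟.carrier) (dom : Set ℝ) (s₀ : ℝ) (x : U) (w : E4),
      𝒟.metric.IsNormalisedNullRayFrom 𝒟.timeOrientation 𝒟.embed 𝒟.normal p γ dom → s₀ ∈ dom →
      0 ≤ s₀ → γ s₀ = Φ x → t₁ ≤ x.1 0 → x.1 0 + R < E4.spatialNorm x.1 →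
      E4.spatialNorm x.1 ≤ x.1 0 + R' → Φ x ∈ closure O →
      velocity (𝓡 4) γ s₀ = mfderiv 𝓘(ℝ, E4) (𝓡 4) Φ x w → w 0 ≤ 2 →
      ¬ BddAbove dom ∨ ∃ (s : ℝ) (y : d'.flatDomain) (w' : E4), s ∈ dom ∧ s₀ ≤ s ∧
      γ s ∈ 𝒟.metric.causalFuture 𝒟.timeOrientation {γ s₀} ∧ γ s = d'.flatChart y ∧
      d'.τ₀ < y.1 0 ∧ τ ≤ y.1 0 ∧ {z : E4 | y.1 0 ≤ z 0 ∧ z 0 ≤ y.1 0 + T ∧ ‖E4.spatial z -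
      E4.spatial y.1‖ ≤ 2 * (z 0 - y.1 0) + 1} ⊆ (d'.flatDomain : Set E4) ∧
      velocity (𝓡 4) γ s = mfderiv 𝓘(ℝ, E4) (𝓡 4) d'.flatChart y w' ∧ 0 < w' 0 ∧ w' 0 ≤ L := by
  intro X _ _ _ _ _ _ D hD 𝒟 hmax O d hO hexh hfo K R C U Φ hΦ _
  obtain ⟨c, hc, hcovR⟩ := stub_lateBandCoverage X D hD 𝒟 hmax O d hO hexh hfo K R C U Φ hΦ
  obtain ⟨L, hL, htrε⟩ := stub_rayTransience X D hD 𝒟 hmax O d hO hexh hfo K R C U Φ hΦ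
  refine ⟨O, d, L, hL, fun R' τ T ↦ ?_⟩
  obtain ⟨tA, htA⟩ := hcovR R'
  obtain ⟨tB, htB⟩ := htrε c R' hc
  refine ⟨max (max tA tB) ((|d.τ₀| + |τ| + 4 * |T| + 3) / c),
    fun p γ dom s₀ x w hγ hs₀dom hs₀ hγx hxt hxR hxR' hcl hvel hw2 ↦ ?_⟩
  -- unpack the lateness threshold
  have hxA : tA ≤ x.1 0 := le_trans (le_trans (le_max_left _ _) (le_max_left _ _)) hxt
  have hxB : tB ≤ x.1 0 := le_trans (le_trans (le_max_right _ _) (le_max_left _ _)) hxt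
  have hxc : (|d.τ₀| + |τ| + 4 * |T| + 3) / c ≤ x.1 0 := le_trans (le_max_right _ _) hxt
  have hcx : |d.τ₀| + |τ| + 4 * |T| + 3 ≤ c * x.1 0 := by
    rw [div_le_iff₀ hc] at hxc
    linarith [hxc]
  have hτ₀abs : d.τ₀ ≤ |d.τ₀| := le_abs_self _
  have hτabs : τ ≤ |τ| := le_abs_self _
  have hTabs : T ≤ |T| := le_abs_self _
  have hTnn : 0 ≤ |T| := abs_nonneg _
  have hτnn : 0 ≤ |τ| := abs_nonneg _
  have hτ₀nn : 0 ≤ |d.τ₀| := abs_nonneg _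
  -- coverage: the entry point is flat-charted late with linear room
  obtain ⟨y, hyx, hyc, hroom⟩ := htA x hxA hxR hxR' hcl
  have hlate : d.τ₀ < y.1 0 - c * x.1 0 := by linarith
  -- transience along the ray
  rcases htB p γ dom s₀ x w y hγ hs₀dom hs₀ hγx hxB hxR hxR' hvel hw2 hyx hlate hroom with hc' |
      ⟨s, y', w', hsdom, hs₀s, hγy', hyy', hdt, hdx, hvel', hw'0, hw'L⟩
  · exact Or.inl hc'
  · refine Or.inr ⟨s, y', w', hsdom, hs₀s, ?_, hγy', ?_, ?_, ?_, hvel', hw'0, hw'L⟩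
    · exact nullRay_apply_mem_causalFuture 𝒟.toSpacetime hγ.1 hγ.2.1 hγ.2.2.2.1
        hγ.2.2.2.2.1 hs₀dom hsdom hs₀s
    · linarith
    · linarith
    · intro z hz
      obtain ⟨hz1, hz2, hz3⟩ := hz
      refine hroom ⟨?_, ?_⟩
      · have h1 : |z 0 - y'.1 0| ≤ |T| := by
          rw [abs_le]; constructor <;> linarith
        calc |z 0 - y.1 0| ≤ |z 0 - y'.1 0| + |y'.1 0 - y.1 0| := abs_sub_le _ _ _
          _ ≤ |T| + c * x.1 0 / 2 := by linarith
          _ ≤ c * x.1 0 := by linarith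
      · calc ‖E4.spatial z - E4.spatial y.1‖
            ≤ ‖E4.spatial z - E4.spatial y'.1‖ + ‖E4.spatial y'.1 - E4.spatial y.1‖ :=
              norm_sub_le_norm_sub_add_norm_sub _ _ _
          _ ≤ (2 * (z 0 - y'.1 0) + 1) + c * x.1 0 / 2 := by linarith
          _ ≤ (2 * |T| + 1) + c * x.1 0 / 2 := by linarith
          _ ≤ c * x.1 0 := by linarith

/-- **Stub S_A (`stub_farExteriorNullCompleteness`), DERIVED: registered signature verbatim, by
projection of `stub_farExteriorControl` onto its COMPLETE clause.** For every admissible vacuum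
datum and every maximal vacuum Cauchy development there is a compact `K ⊆ Σ` such that every
normalised future null ray from the data hypersurface which never enters `J⁺(ι K)` is future
complete (Klainerman–Nicolò-type exterior completeness for the admissible class). -/
theorem stub_farExteriorNullCompleteness :
    ∀ (X : Type) [TopologicalSpace X] [ChartedSpace E3 X] [IsManifold (𝓡 3) ∞ X] [T2Space X]
      [SecondCountableTopology X] [ConnectedSpace X], ∀ D ∈ admissibleVacuumData X, ∀ 𝒟 :
      VacuumCauchyDevelopment D, 𝒟.IsMaximal → ∀ [𝒟.metric.HasLeviCivita], ∃ K : Set X, IsCompact K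
      ∧ ∀ (p : X) (γ : ℝ → 𝒟.carrier) (dom : Set ℝ), 𝒟.metric.IsNormalisedNullRayFrom
      𝒟.timeOrientation 𝒟.embed 𝒟.normal p γ dom → (∀ t ∈ dom, 0 ≤ t → γ t ∉ 𝒟.metric.causalFuture
      𝒟.timeOrientation (𝒟.embed '' K)) → ¬ BddAbove dom := by
  intro X _ _ _ _ _ _ D hD 𝒟 hmax _
  obtain ⟨K, -, -, -, -, hK, hcomplete, -⟩ := stub_farExteriorControl X D hD 𝒟 hmax
  exact ⟨K, hK, hcomplete⟩

/-- **Stub S_B (`stub_radiationZoneEntry`), DERIVED: registered signature verbatim, from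
`stub_farExteriorControl` (F″) and `stub_entryBandGlue_eventual` (G′) by causal bookkeeping
(skeleton v4).** A far-complete maximal development of admissible data that settles (re-typed
matrix) admits, for every compact `Bₑ`, a compact `B₀ ⊇ Bₑ`, a `C²` decomposition, a Doppler bound
`L` and, for all `τ, T`, a compact `B₁` beyond which every normalised null ray entering `J⁺(ι B₀)`
is complete or has an ENTRY EVENT (late flat-charted point of `J⁺(ι B₀)`, chart velocity `dΨ w'`
with `0 < w'⁰ ≤ L`, height-`T` cone in the flat domain). Proof: `K_h` from `hfar`; F″ gives the
far chart, ESCAPE at `K' := K_h` (a compact `K''`) and FAR ENTRY at `K' := K''` (a compact `B*`,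
then `R'` for `B₀ := Bₑ ∪ B*`); G′ applied to the settling decomposition and the far chart gives
`d′`, `L`; given `τ, T`, G′ gives `t₁` for `(R', τ, T)` and FAR ENTRY the compact `B₁` for `t₁`. An
entering ray from `p ∉ B₁` has a far entry point `γ s₀ = Φ x ∈ J⁺(ι B₀) ∖ J⁺(ι K'')`, `x⁰ ≥ t₁`, in
the entry band, `w⁰ ≤ 2`; REACH: `γ s₀ ∈ J⁺(ι Σ)` (`nullRay_apply_mem_causalFuture`), so by ESCAPE a
`K_h`-avoiding normalised ray passes through it, complete by `hfar`, hence `γ s₀ ∈ closure O`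
(`RaysStayInClosure`); G′ then gives completeness or a LATER good event `γ s`, `s ≥ s₀`, flat-charted
late with room and pinned, and `γ s ∈ J⁺(J⁺(ι B₀)) ⊆ J⁺(ι B₀)`
(`Spacetime.causalFuture_causalFuture_subset`). -/
theorem stub_radiationZoneEntry :
    ∀ (X : Type) [TopologicalSpace X] [ChartedSpace E3 X] [IsManifold (𝓡 3) ∞ X] [T2Space X]
      [SecondCountableTopology X] [ConnectedSpace X], ∀ D ∈ admissibleVacuumData X, ∀ 𝒟 :
      VacuumCauchyDevelopment D, 𝒟.IsMaximal → (∀ [𝒟.metric.HasLeviCivita], ∃ K : Set X, IsCompact K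
      ∧ ∀ (p : X) (γ : ℝ → 𝒟.carrier) (dom : Set ℝ), 𝒟.metric.IsNormalisedNullRayFrom
      𝒟.timeOrientation 𝒟.embed 𝒟.normal p γ dom → (∀ t ∈ dom, 0 ≤ t → γ t ∉ 𝒟.metric.causalFuture
      𝒟.timeOrientation (𝒟.embed '' K)) → ¬ BddAbove dom) → (∃ (O : Set 𝒟.carrier) (d :
      FinalStateDecomposition 𝒟.toSpacetime O 2), (∀ i, Kerr.IsSubextremal (d.mass i) (d.spin i)) ∧
      O = Summit.FinalStateConjecture.exteriorOf 𝒟.toCauchyDevelopment d.charted ∧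
      Summit.FinalStateConjecture.RaysStayInClosure 𝒟.toCauchyDevelopment O ∧
      Summit.FinalStateConjecture.HasExhaustiveCharts d ∧
      Summit.FinalStateConjecture.IsFutureOriented d) → ∀ [𝒟.metric.HasLeviCivita], ∀ Bₑ : Set X,
      IsCompact Bₑ → ∃ B₀ : Set X, IsCompact B₀ ∧ Bₑ ⊆ B₀ ∧ ∃ (O'' : Set 𝒟.carrier) (d :
      FinalStateDecomposition 𝒟.toSpacetime O'' 2) (L : ℝ), 0 < L ∧ ∀ τ T : ℝ, ∃ B₁ : Set X,
      IsCompact B₁ ∧ ∀ p ∉ B₁, ∀ (γ : ℝ → 𝒟.carrier) (dom : Set ℝ), 𝒟.metric.IsNormalisedNullRayFrom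
      𝒟.timeOrientation 𝒟.embed 𝒟.normal p γ dom → (∃ t ∈ dom, 0 ≤ t ∧ γ t ∈ 𝒟.metric.causalFuture
      𝒟.timeOrientation (𝒟.embed '' B₀)) → ¬ BddAbove dom ∨ ∃ (s₀ : ℝ) (y : d.flatDomain) (w : E4),
      s₀ ∈ dom ∧ 0 ≤ s₀ ∧ γ s₀ ∈ 𝒟.metric.causalFuture 𝒟.timeOrientation (𝒟.embed '' B₀) ∧ γ s₀ =
      d.flatChart y ∧ d.τ₀ < y.1 0 ∧ τ ≤ y.1 0 ∧ velocity (𝓡 4) γ s₀ = mfderiv 𝓘(ℝ, E4) (𝓡 4)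
      d.flatChart y w ∧ 0 < w 0 ∧ w 0 ≤ L ∧ {z : E4 | y.1 0 ≤ z 0 ∧ z 0 ≤ y.1 0 + T ∧ ‖E4.spatial z
      - E4.spatial y.1‖ ≤ 2 * (z 0 - y.1 0) + 1} ⊆ (d.flatDomain : Set E4) := by
  intro X _ _ _ _ _ _ D hD 𝒟 hmax hfar hsettles _ Bₑ hBₑ
  obtain ⟨Kh, hKh, hcomplete⟩ := hfar
  obtain ⟨O, d, -, hO, hRSIC, hexh, hfo⟩ := hsettles
  obtain ⟨Kf, R, C, U, Φ, -, -, hΦ, hesc, hent⟩ := stub_farExteriorControl X D hD 𝒟 hmax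
  obtain ⟨K'', hK'', hescape⟩ := hesc Kh hKh
  obtain ⟨Bs, hBs, hentry⟩ := hent K'' hK''
  obtain ⟨O', d', L, hL, hglue⟩ :=
    stub_entryBandGlue_eventual X D hD 𝒟 hmax O d hO hexh hfo Kf R C U Φ hΦ
  obtain ⟨R', hR'⟩ := hentry (Bₑ ∪ Bs) (hBₑ.union hBs) subset_union_right
  refine ⟨Bₑ ∪ Bs, hBₑ.union hBs, subset_union_left, O', d', L, hL, fun τ T ↦ ?_⟩
  obtain ⟨t₁, ht₁⟩ := hglue R' τ T
  obtain ⟨B₁, hB₁, hray⟩ := hR' t₁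
  refine ⟨B₁, hB₁, fun p hp γ dom hγ hin ↦ ?_⟩
  obtain ⟨s₀, x, w, hs₀dom, hs₀, hJB, hJK, hγx, hxt, hxR, hxR', hvel, -, hw2⟩ :=
    hray p hp γ dom hγ hin
  -- REACH: the far entry point lies in `closure O`
  have hJrange : γ s₀ ∈ 𝒟.metric.causalFuture 𝒟.timeOrientation (range 𝒟.embed) := by
    have h := nullRay_apply_mem_causalFuture 𝒟.toSpacetime hγ.1 hγ.2.1 hγ.2.2.2.1
      hγ.2.2.2.2.1 hγ.2.1 hs₀dom hs₀
    rw [hγ.2.2.1] at h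
    exact LorentzianMetric.causalFuture_mono (singleton_subset_iff.2 (mem_range_self p)) h
  obtain ⟨p', γ', dom', t', hγ', ht'dom, ht', hγ't', havoid⟩ := hescape (γ s₀) hJrange hJK
  have hcl : Φ x ∈ closure O := by
    rw [← hγx, ← hγ't']
    exact hRSIC p' γ' dom' hγ' (hcomplete p' γ' dom' hγ' havoid) t' ht'dom ht'
  -- G′: completeness, or a later good event on the same ray
  rcases ht₁ p γ dom s₀ x w hγ hs₀dom hs₀ hγx hxt hxR hxR' hcl hvel hw2 with hc |
      ⟨s, y, w', hsdom, hs₀s, hJs, hγy, hτ₀, hτy, hcone, hvel', hw'0, hw'L⟩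
  · exact Or.inl hc
  · refine Or.inr ⟨s, y, w', hsdom, hs₀.trans hs₀s, ?_, hγy, hτ₀, hτy, hvel', hw'0, hw'L, hcone⟩
    exact Spacetime.causalFuture_causalFuture_subset 𝒟.toSpacetime _
      (LorentzianMetric.causalFuture_mono (singleton_subset_iff.2 hJB) hJs)

/-- **Stub S_C (`stub_scriOfEntry`; the entering-half plumbing, closable now).** A maximal vacuum
Cauchy development of admissible data which is far-exterior null complete and has entry events in
the sense of S_B has complete future null infinity in Christodoulou's sojourn form: `B₀` from the
entry statement at `Bₑ := K`; a ray from outside `B₁` avoiding `J⁺(ι B₀) ⊇ J⁺(ι K)` is complete by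
far completeness; an entering, non-complete ray has an entry event, its velocity there is null, and
the LANDED rate-free flat-zone sojourn lever
(`StarvedNecks.OneOverDelta.stub_flatZoneSojourn`, one-sided Grönwall on `log ẋ⁰`) with
`δ := min δ₀ (1/(2CLs))`, `T := 1/(Cδ)` and lateness from `d.tendsto_deviationCk_flat` keeps it inside
the flat domain, hence inside `J⁺(ι B₀)`, for affine time `≥ s` — the proof of p112248, read per
development, plus five lines of assembly (p112138 shape). -/
theorem stub_scriOfEntry :
    ∀ (X : Type) [TopologicalSpace X] [ChartedSpace E3 X] [IsManifold (𝓡 3) ∞ X] [T2Space X]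
      [SecondCountableTopology X] [ConnectedSpace X], ∀ D ∈ admissibleVacuumData X, ∀ 𝒟 :
      VacuumCauchyDevelopment D, 𝒟.IsMaximal → (∀ [𝒟.metric.HasLeviCivita], ∃ K : Set X, IsCompact K
      ∧ ∀ (p : X) (γ : ℝ → 𝒟.carrier) (dom : Set ℝ), 𝒟.metric.IsNormalisedNullRayFrom
      𝒟.timeOrientation 𝒟.embed 𝒟.normal p γ dom → (∀ t ∈ dom, 0 ≤ t → γ t ∉ 𝒟.metric.causalFuture
      𝒟.timeOrientation (𝒟.embed '' K)) → ¬ BddAbove dom) → (∀ [𝒟.metric.HasLeviCivita], ∀ Bₑ : Set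
      X, IsCompact Bₑ → ∃ B₀ : Set X, IsCompact B₀ ∧ Bₑ ⊆ B₀ ∧ ∃ (O'' : Set 𝒟.carrier) (d :
      FinalStateDecomposition 𝒟.toSpacetime O'' 2) (L : ℝ), 0 < L ∧ ∀ τ T : ℝ, ∃ B₁ : Set X,
      IsCompact B₁ ∧ ∀ p ∉ B₁, ∀ (γ : ℝ → 𝒟.carrier) (dom : Set ℝ), 𝒟.metric.IsNormalisedNullRayFrom
      𝒟.timeOrientation 𝒟.embed 𝒟.normal p γ dom → (∃ t ∈ dom, 0 ≤ t ∧ γ t ∈ 𝒟.metric.causalFuture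
      𝒟.timeOrientation (𝒟.embed '' B₀)) → ¬ BddAbove dom ∨ ∃ (s₀ : ℝ) (y : d.flatDomain) (w : E4),
      s₀ ∈ dom ∧ 0 ≤ s₀ ∧ γ s₀ ∈ 𝒟.metric.causalFuture 𝒟.timeOrientation (𝒟.embed '' B₀) ∧ γ s₀ =
      d.flatChart y ∧ d.τ₀ < y.1 0 ∧ τ ≤ y.1 0 ∧ velocity (𝓡 4) γ s₀ = mfderiv 𝓘(ℝ, E4) (𝓡 4)
      d.flatChart y w ∧ 0 < w 0 ∧ w 0 ≤ L ∧ {z : E4 | y.1 0 ≤ z 0 ∧ z 0 ≤ y.1 0 + T ∧ ‖E4.spatial z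
      - E4.spatial y.1‖ ≤ 2 * (z 0 - y.1 0) + 1} ⊆ (d.flatDomain : Set E4)) →
      Summit.FinalStateConjecture.HasCompleteNullInfinity 𝒟.toCauchyDevelopment :=
  -- CLOSED (wave 1, p139865): the landed helper, registered signature verbatim.
  Summit.FinalStateConjecture.FinalStateConjecture.Theorems.stub_scriOfEntry

/-- **Stub S_D (`stub_anchoredRecurrenceSettles`; the capture core, hardest).** For some order `k`,
every maximal vacuum Cauchy development of admissible data satisfying the hypothesis of
`RecurrentMultiKerrCapture` at order `k` VERBATIM (rev 21: anchored, separating, exhaustive,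
ray-complete, future-oriented final-state-shaped late charts in which `Cᵏ` `ε`-closeness to one
receding sub-extremal multi-Kerr configuration recurs for every `ε` and every near-zone radius)
settles down in the re-typed sense. This is X minus its complete-`𝓘⁺` conjunct (split child
`AnchoredRecurrenceSettles`; necessary: `anchoredRecurrenceSettles_of_recurrentMultiKerrCapture`,
evidence SplitT2.lean) — the declared research core: `N = 0` dispersal from recurrent unweighted
slab flatness; `N = 1` ⊇ asymptotic stability of the sub-extremal Kerr family from a RECURRENCE
hypothesis (printed consumers take i⁰-anchored weighted-Sobolev Cauchy balls with the same ADM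
parameters — Klainerman–Szeftel 2023 Main Theorem, Hintz arXiv:2606.28253 Thm 13.1 — which no late
Cauchy leaf of a radiating spacetime inhabits; the restart must be LAYER-form, its smallness
manufactured from recurrence + admissibility across the far exterior AND the wave zone); `N ≥ 2`
open even linearly, plus the equal-final-velocity sector where the route's engine is void. Exit for
the lead: the harness-offered split on the final cycle (children + glue prepared by the strategist). -/
theorem stub_anchoredRecurrenceSettles :
    ∃ k : ℕ, ∀ (X : Type) [TopologicalSpace X] [ChartedSpace E3 X] [IsManifold (𝓡 3) ∞ X] [T2Space
      X] [SecondCountableTopology X] [ConnectedSpace X], ∀ D ∈ admissibleVacuumData X, ∀ 𝒟 :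
      VacuumCauchyDevelopment D, 𝒟.IsMaximal → (∃ (O : Set 𝒟.carrier) (N : ℕ) (M a : Fin N → ℝ) (mo
      : Fin N → lorentzGroup × E4) (τ₀ : ℝ) (Ψ : ∀ i, boostedKerrExterior (mo i).1 (mo i).2 (M i) (a
      i) → 𝒟.carrier) (ρ R : Fin N → ℝ → ℝ) (U₀ : Opens E4) (Ψ₀ : U₀ → 𝒟.carrier), (∀ i,
      Kerr.IsSubextremal (M i) (a i)) ∧ (∀ i, 𝒟.toSpacetime.IsLateChart (boostedKerrBackground (mo
      i).1 (mo i).2 (M i) (a i)) O τ₀ (Ψ i)) ∧ 𝒟.toSpacetime.IsLateChart (Minkowski.backgroundOn U₀)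
      O τ₀ Ψ₀ ∧ (∀ i, Tendsto (fun t ↦ ρ i t / t) atTop (𝓝 0)) ∧ (∀ i, Tendsto (R i) atTop atTop ∧ ∀
      τ, max (Kerr.rPlus (M i) (a i)) 0 + 1 ≤ R i τ) ∧ {x : E4 | τ₀ < x 0 ∧ ∀ i, ρ i (x 0) <
      Kerr.radius (a i) (poincareInv (mo i).1 (mo i).2 x)} ⊆ (U₀ : Set E4) ∧ (∀ R' : ℝ, ∃ τ₁ : ℝ,
      Pairwise (Function.onFun Disjoint fun i ↦ Ψ i '' (boostedKerrBackground (mo i).1 (mo i).2 (M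
      i) (a i)).truncLateRegion τ₁ R')) ∧ O = Summit.FinalStateConjecture.exteriorOf
      𝒟.toCauchyDevelopment ((⋃ i, Ψ i '' (boostedKerrBackground (mo i).1 (mo i).2 (M i) (a
      i)).lateRegion τ₀) ∪ Ψ₀ '' (Minkowski.backgroundOn U₀).lateRegion τ₀) ∧
      Summit.FinalStateConjecture.RaysStayInClosure 𝒟.toCauchyDevelopment O ∧ (∀ τ₁ : ℝ, τ₀ < τ₁ → O
      \ (Ψ₀ '' (Minkowski.backgroundOn U₀).lateRegion τ₁ ∪ ⋃ i, Ψ i '' {x | τ₁ <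
      (boostedKerrBackground (mo i).1 (mo i).2 (M i) (a i)).time x.1 ∧ (boostedKerrBackground (mo
      i).1 (mo i).2 (M i) (a i)).radius x.1 ≤ R i ((boostedKerrBackground (mo i).1 (mo i).2 (M i) (a
      i)).time x.1)}) ⊆ 𝒟.metric.causalPast 𝒟.timeOrientation (Ψ₀ '' (Minkowski.backgroundOn
      U₀).timeSlab τ₁ ∪ ⋃ i, Ψ i '' (boostedKerrBackground (mo i).1 (mo i).2 (M i) (a
      i)).truncTimeSlab (R i τ₁) τ₁)) ∧ ((∀ i, Summit.FinalStateConjecture.IsOrthochronous (mo i).1)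
      ∧ ∀ τ : ℝ, τ₀ < τ → ∀ x ∈ (Minkowski.backgroundOn U₀).timeSlab τ,
      𝒟.toSpacetime.timeOrientation.IsFutureDirected (mfderiv 𝓘(ℝ, E4) (𝓡 4) Ψ₀ x (E4.basisVector
      0))) ∧ (∀ τ : ℝ, τ₀ < τ → 𝒟.toSpacetime.deviationCk (Minkowski.backgroundOn U₀) Ψ₀ 0 τ ≤
      ENNReal.ofReal (1 / 4) ∧ ∀ i, 𝒟.toSpacetime.truncDeviationCk (boostedKerrBackground (mo i).1
      (mo i).2 (M i) (a i)) (Ψ i) 0 (R i τ) τ ≤ ENNReal.ofReal (1 / 4)) ∧ ∀ R' : ℝ, ∀ ε : ℝ, 0 < ε →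
      ∃ᶠ τ in atTop, 𝒟.toSpacetime.deviationCk (Minkowski.backgroundOn U₀) Ψ₀ k τ ≤ ENNReal.ofReal ε
      ∧ ∀ i, 𝒟.toSpacetime.truncDeviationCk (boostedKerrBackground (mo i).1 (mo i).2 (M i) (a i)) (Ψ
      i) k R' τ ≤ ENNReal.ofReal ε ∧ ∀ x ∈ (boostedKerrBackground (mo i).1 (mo i).2 (M i) (a
      i)).truncTimeSlab R' τ, 𝒟.toSpacetime.timeOrientation.IsFutureDirected (mfderiv 𝓘(ℝ, E4) (𝓡 4)
      (Ψ i) x (((mo i).1 : E4 ≃L[ℝ] E4) (Kerr.timeVector (M i) (a i) (poincareInv (mo i).1 (mo i).2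
      (x : E4)))))) → ∃ (O : Set 𝒟.carrier) (d : FinalStateDecomposition 𝒟.toSpacetime O 2), (∀ i,
      Kerr.IsSubextremal (d.mass i) (d.spin i)) ∧ O = Summit.FinalStateConjecture.exteriorOf
      𝒟.toCauchyDevelopment d.charted ∧ Summit.FinalStateConjecture.RaysStayInClosure
      𝒟.toCauchyDevelopment O ∧ Summit.FinalStateConjecture.HasExhaustiveCharts d ∧
      Summit.FinalStateConjecture.IsFutureOriented d := by
  sorry

/-- **Composition.** The four stubs prove the crux BY NAME: discard the inert engine binder, take
`k` from S_D; for a development satisfying X's hypothesis at order `k`, S_D gives the settle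
matrix, S_A far-exterior completeness, S_B the entry events, S_C complete `𝓘⁺`. Pure logic; the
only `sorry`s are inside the four stubs it names. -/
theorem LinearToNonlinearCapture_of :
    Summit.FinalStateConjecture.FinalStateConjecture.Theses.ClusterCompleteness.LinearToNonlinearCapture := by
  intro _
  obtain ⟨k, hk⟩ := stub_anchoredRecurrenceSettles
  refine ⟨k, ?_⟩
  intro X _ _ _ _ _ _ D hDa 𝒟 hmax hhyp
  have hs := hk X D hDa 𝒟 hmax hhyp
  have hfar := @stub_farExteriorNullCompleteness X _ _ _ _ _ _ D hDa 𝒟 hmax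
  have hent := @stub_radiationZoneEntry X _ _ _ _ _ _ D hDa 𝒟 hmax hfar hs
  exact ⟨@stub_scriOfEntry X _ _ _ _ _ _ D hDa 𝒟 hmax hfar hent, hs⟩

/-- **Tightness of S_D**: the route target implies the capture stub (it is X minus a conjunct). -/
theorem stub_anchoredRecurrenceSettles_of_target
    (h : Summit.FinalStateConjecture.FinalStateConjecture.Theses.ClusterCompleteness.RecurrentMultiKerrCapture) :
    ∃ k : ℕ, ∀ (X : Type) [TopologicalSpace X] [ChartedSpace E3 X] [IsManifold (𝓡 3) ∞ X] [T2Space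
      X] [SecondCountableTopology X] [ConnectedSpace X], ∀ D ∈ admissibleVacuumData X, ∀ 𝒟 :
      VacuumCauchyDevelopment D, 𝒟.IsMaximal → (∃ (O : Set 𝒟.carrier) (N : ℕ) (M a : Fin N → ℝ) (mo
      : Fin N → lorentzGroup × E4) (τ₀ : ℝ) (Ψ : ∀ i, boostedKerrExterior (mo i).1 (mo i).2 (M i) (a
      i) → 𝒟.carrier) (ρ R : Fin N → ℝ → ℝ) (U₀ : Opens E4) (Ψ₀ : U₀ → 𝒟.carrier), (∀ i,
      Kerr.IsSubextremal (M i) (a i)) ∧ (∀ i, 𝒟.toSpacetime.IsLateChart (boostedKerrBackground (mo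
      i).1 (mo i).2 (M i) (a i)) O τ₀ (Ψ i)) ∧ 𝒟.toSpacetime.IsLateChart (Minkowski.backgroundOn U₀)
      O τ₀ Ψ₀ ∧ (∀ i, Tendsto (fun t ↦ ρ i t / t) atTop (𝓝 0)) ∧ (∀ i, Tendsto (R i) atTop atTop ∧ ∀
      τ, max (Kerr.rPlus (M i) (a i)) 0 + 1 ≤ R i τ) ∧ {x : E4 | τ₀ < x 0 ∧ ∀ i, ρ i (x 0) <
      Kerr.radius (a i) (poincareInv (mo i).1 (mo i).2 x)} ⊆ (U₀ : Set E4) ∧ (∀ R' : ℝ, ∃ τ₁ : ℝ,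
      Pairwise (Function.onFun Disjoint fun i ↦ Ψ i '' (boostedKerrBackground (mo i).1 (mo i).2 (M
      i) (a i)).truncLateRegion τ₁ R')) ∧ O = Summit.FinalStateConjecture.exteriorOf
      𝒟.toCauchyDevelopment ((⋃ i, Ψ i '' (boostedKerrBackground (mo i).1 (mo i).2 (M i) (a
      i)).lateRegion τ₀) ∪ Ψ₀ '' (Minkowski.backgroundOn U₀).lateRegion τ₀) ∧
      Summit.FinalStateConjecture.RaysStayInClosure 𝒟.toCauchyDevelopment O ∧ (∀ τ₁ : ℝ, τ₀ < τ₁ → O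
      \ (Ψ₀ '' (Minkowski.backgroundOn U₀).lateRegion τ₁ ∪ ⋃ i, Ψ i '' {x | τ₁ <
      (boostedKerrBackground (mo i).1 (mo i).2 (M i) (a i)).time x.1 ∧ (boostedKerrBackground (mo
      i).1 (mo i).2 (M i) (a i)).radius x.1 ≤ R i ((boostedKerrBackground (mo i).1 (mo i).2 (M i) (a
      i)).time x.1)}) ⊆ 𝒟.metric.causalPast 𝒟.timeOrientation (Ψ₀ '' (Minkowski.backgroundOn
      U₀).timeSlab τ₁ ∪ ⋃ i, Ψ i '' (boostedKerrBackground (mo i).1 (mo i).2 (M i) (a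
      i)).truncTimeSlab (R i τ₁) τ₁)) ∧ ((∀ i, Summit.FinalStateConjecture.IsOrthochronous (mo i).1)
      ∧ ∀ τ : ℝ, τ₀ < τ → ∀ x ∈ (Minkowski.backgroundOn U₀).timeSlab τ,
      𝒟.toSpacetime.timeOrientation.IsFutureDirected (mfderiv 𝓘(ℝ, E4) (𝓡 4) Ψ₀ x (E4.basisVector
      0))) ∧ (∀ τ : ℝ, τ₀ < τ → 𝒟.toSpacetime.deviationCk (Minkowski.backgroundOn U₀) Ψ₀ 0 τ ≤
      ENNReal.ofReal (1 / 4) ∧ ∀ i, 𝒟.toSpacetime.truncDeviationCk (boostedKerrBackground (mo i).1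
      (mo i).2 (M i) (a i)) (Ψ i) 0 (R i τ) τ ≤ ENNReal.ofReal (1 / 4)) ∧ ∀ R' : ℝ, ∀ ε : ℝ, 0 < ε →
      ∃ᶠ τ in atTop, 𝒟.toSpacetime.deviationCk (Minkowski.backgroundOn U₀) Ψ₀ k τ ≤ ENNReal.ofReal ε
      ∧ ∀ i, 𝒟.toSpacetime.truncDeviationCk (boostedKerrBackground (mo i).1 (mo i).2 (M i) (a i)) (Ψ
      i) k R' τ ≤ ENNReal.ofReal ε ∧ ∀ x ∈ (boostedKerrBackground (mo i).1 (mo i).2 (M i) (a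
      i)).truncTimeSlab R' τ, 𝒟.toSpacetime.timeOrientation.IsFutureDirected (mfderiv 𝓘(ℝ, E4) (𝓡 4)
      (Ψ i) x (((mo i).1 : E4 ≃L[ℝ] E4) (Kerr.timeVector (M i) (a i) (poincareInv (mo i).1 (mo i).2
      (x : E4)))))) → ∃ (O : Set 𝒟.carrier) (d : FinalStateDecomposition 𝒟.toSpacetime O 2), (∀ i,
      Kerr.IsSubextremal (d.mass i) (d.spin i)) ∧ O = Summit.FinalStateConjecture.exteriorOf
      𝒟.toCauchyDevelopment d.charted ∧ Summit.FinalStateConjecture.RaysStayInClosure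
      𝒟.toCauchyDevelopment O ∧ Summit.FinalStateConjecture.HasExhaustiveCharts d ∧
      Summit.FinalStateConjecture.IsFutureOriented d := by
  obtain ⟨k, hk⟩ := h
  refine ⟨k, ?_⟩
  intro X _ _ _ _ _ _ D hD 𝒟 hmax hhyp
  exact (hk X D hD 𝒟 hmax hhyp).2

/-- **The scri column alone**: the three scri stubs give complete `𝓘⁺` for EVERY settled
maximal development of admissible data (recurrence-free, `N`-free, engine-free) — the summit-wide
statement `settled ⇒ complete scri`, here modulo the stubs it names. -/
theorem scri_of_settled_of_stubs :
    ∀ (X : Type) [TopologicalSpace X] [ChartedSpace E3 X] [IsManifold (𝓡 3) ∞ X] [T2Space X]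
      [SecondCountableTopology X] [ConnectedSpace X], ∀ D ∈ admissibleVacuumData X, ∀ 𝒟 :
      VacuumCauchyDevelopment D, 𝒟.IsMaximal → (∃ (O : Set 𝒟.carrier) (d : FinalStateDecomposition
      𝒟.toSpacetime O 2), (∀ i, Kerr.IsSubextremal (d.mass i) (d.spin i)) ∧ O =
      Summit.FinalStateConjecture.exteriorOf 𝒟.toCauchyDevelopment d.charted ∧
      Summit.FinalStateConjecture.RaysStayInClosure 𝒟.toCauchyDevelopment O ∧
      Summit.FinalStateConjecture.HasExhaustiveCharts d ∧
      Summit.FinalStateConjecture.IsFutureOriented d) →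
      Summit.FinalStateConjecture.HasCompleteNullInfinity 𝒟.toCauchyDevelopment := by
  intro X _ _ _ _ _ _ D hDa 𝒟 hmax hs
  have hfar := @stub_farExteriorNullCompleteness X _ _ _ _ _ _ D hDa 𝒟 hmax
  exact @stub_scriOfEntry X _ _ _ _ _ _ D hDa 𝒟 hmax hfar
    (@stub_radiationZoneEntry X _ _ _ _ _ _ D hDa 𝒟 hmax hfar hs)

end Summit.FinalStateConjecture.FinalStateConjecture.Cruxes.LinearToNonlinearCapture.ExteriorEntryCapture
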